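import Mathlib
import Summits.Ventures.PercRepro2.Defs
import Summits.Ventures.PercRepro2.Independence
import Summits.Ventures.PercRepro2.Graph
import Summits.Ventures.PercRepro2.Exploration
import Summits.Ventures.PercRepro2.Induced
import Summits.Ventures.PercRepro2.HubModel

/-!
# The hub law: root-bundle states ⊥ inner pattern, and the partition formula
(blind cell PercRepro2, typer-1 g8; MINE2-HUB.md §2 (a), §5 (i)–(ii))

The model graph of `HubModel.lean` depends on the configuration only through
* the **root-bundle state** `rootState ends μ ω : Fin 7 → Bool` — which of the seven root bundles
  `a₁o, a₁a₃, a₁b, a₂o, a₂a₃, a₂b, a₁a₂` (`bundle`) has an open edge, and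
* the **inner pattern** `innerPat ends μ ω : Fin 3 → Bool` — which of the three inner pairs
  `oa₃, a₃b, ob` (`ipair`) is connected in `G′ = G − {a₁, a₂}`:
`modelGraph ends μ ω = modelGraphOf (rootState ends μ ω) (innerPat ends μ ω)`
(`modelGraph_eq_modelGraphOf`), where `modelGraphOf w π` is a computable graph on the five marks
(its reachability is decidable, so five-mark truth tables are `decide`-able).

The root-bundle state is determined by the edges at the roots (`dependsOn_rootState`), the inner
pattern by the other edges (`dependsOn_innerPat`), hence `P(W = w, Π = π) = P(W = w) · P(Π = π)`
(`prob_rootState_inter_innerPat`) and, for every event `{Φ(W, Π)}`,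
`P(Φ(W, Π)) = Σ_w Σ_π 1[Φ(w, π)] · P(W = w) · P(Π = π)` (`prob_hubEvent`) — the hub law
`L(p, m)` of MINE2-HUB.md §2 (a) with `P(Π = π) = m_π` the inner law (the five consistent
patterns carry all the mass) and `P(W = w)` the root-edge law (its Bernstein form is the next file).
-/

namespace Summit.Ventures.PercRepro2.Hub

/-- The seven root bundles `(root, mark)`. -/
def bundle : Fin 7 → Mark × Mark
  | 0 => (.a₁, .o)
  | 1 => (.a₁, .a₃)
  | 2 => (.a₁, .b)
  | 3 => (.a₂, .o)
  | 4 => (.a₂, .a₃)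
  | 5 => (.a₂, .b)
  | 6 => (.a₁, .a₂)

/-- The three inner pairs. -/
def ipair : Fin 3 → Mark × Mark
  | 0 => (.o, .a₃)
  | 1 => (.a₃, .b)
  | 2 => (.o, .b)

/-- The first mark of every bundle is a root. -/
lemma bundle_fst_isRoot (i : Fin 7) : (bundle i).1.IsRoot := by
  fin_cases i <;> simp [bundle, Mark.IsRoot]

/-- The model adjacency table of a state pair `(w, π)`. -/
def adjOf (w : Fin 7 → Bool) (π : Fin 3 → Bool) : Mark → Mark → Bool
  | .a₁, .o => w 0
  | .o, .a₁ => w 0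
  | .a₁, .a₃ => w 1
  | .a₃, .a₁ => w 1
  | .a₁, .b => w 2
  | .b, .a₁ => w 2
  | .a₂, .o => w 3
  | .o, .a₂ => w 3
  | .a₂, .a₃ => w 4
  | .a₃, .a₂ => w 4
  | .a₂, .b => w 5
  | .b, .a₂ => w 5
  | .a₁, .a₂ => w 6
  | .a₂, .a₁ => w 6
  | .o, .a₃ => π 0
  | .a₃, .o => π 0
  | .a₃, .b => π 1
  | .b, .a₃ => π 1
  | .o, .b => π 2
  | .b, .o => π 2
  | _, _ => false

/-- The model graph of a state pair (computable; reachability is decidable). -/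
def modelGraphOf (w : Fin 7 → Bool) (π : Fin 3 → Bool) : SimpleGraph Mark :=
  SimpleGraph.fromRel (fun u v => adjOf w π u v = true)

/-- Adjacency in the model graph of a state pair is decidable. -/
instance (w : Fin 7 → Bool) (π : Fin 3 → Bool) : DecidableRel (modelGraphOf w π).Adj :=
  fun u v => decidable_of_iff _ (SimpleGraph.fromRel_adj _ u v).symm

variable {V : Type*} {E : Type*}

section State

open Classical

variable (ends : E → Sym2 V) (μ : Mark → V) (ω : Config E)

/-- The root-bundle state: which root bundles have an open edge. -/
noncomputable def rootState : Fin 7 → Bool :=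
  fun i => decide (OpenAdj ends ω (μ (bundle i).1) (μ (bundle i).2))

/-- The inner pattern: which inner pairs are connected in `G′`. -/
noncomputable def innerPat : Fin 3 → Bool :=
  fun i => decide (Conn ends (innerConfig ends μ ω) (μ (ipair i).1) (μ (ipair i).2))

end State

section ModelEq

variable {ends : E → Sym2 V} {μ : Mark → V} {ω : Config E}

/-- Open adjacency is symmetric (iff form). -/
lemma openAdj_comm {x y : V} : OpenAdj ends ω x y ↔ OpenAdj ends ω y x :=
  ⟨OpenAdj.symm, OpenAdj.symm⟩

/-- Connection is symmetric (iff form). -/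
lemma conn_comm {ω' : Config E} {x y : V} : Conn ends ω' x y ↔ Conn ends ω' y x :=
  ⟨conn_symm, conn_symm⟩

/-- The model adjacency of `ω` is the adjacency table of its state pair (off the diagonal). -/
lemma modelAdj_iff_adjOf {u v : Mark} (huv : u ≠ v) :
    modelAdj ends μ ω u v ↔ adjOf (rootState ends μ ω) (innerPat ends μ ω) u v = true := by
  classical
  cases u <;> cases v <;>
    first
    | exact absurd rfl huv
    | (simp only [modelAdj, adjOf, rootState, innerPat, bundle, ipair, Mark.IsRoot,
        decide_eq_true_eq, reduceCtorEq, or_self, or_false, or_true, if_true, if_false] <;>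
       first
       | exact Iff.rfl
       | exact openAdj_comm
       | exact conn_comm)

/-- **The model graph is a function of the state pair.** -/
theorem modelGraph_eq_modelGraphOf :
    modelGraph ends μ ω = modelGraphOf (rootState ends μ ω) (innerPat ends μ ω) := by
  ext u v
  rw [modelGraph, modelGraphOf, SimpleGraph.fromRel_adj, SimpleGraph.fromRel_adj]
  constructor
  · rintro ⟨huv, h | h⟩
    · exact ⟨huv, Or.inl ((modelAdj_iff_adjOf huv).1 h)⟩
    · exact ⟨huv, Or.inr ((modelAdj_iff_adjOf (Ne.symm huv)).1 h)⟩
  · rintro ⟨huv, h | h⟩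
    · exact ⟨huv, Or.inl ((modelAdj_iff_adjOf huv).2 h)⟩
    · exact ⟨huv, Or.inr ((modelAdj_iff_adjOf (Ne.symm huv)).2 h)⟩

/-- **Five-mark connectivity in the class R as a function of the state pair.** -/
theorem conn_iff_reachable_state (hinj : Function.Injective μ) (hR : ClassR ends μ) (u v : Mark) :
    Conn ends ω (μ u) (μ v) ↔
      (modelGraphOf (rootState ends μ ω) (innerPat ends μ ω)).Reachable u v := by
  rw [conn_iff_modelReachable hinj hR, modelGraph_eq_modelGraphOf]

end ModelEq

section Independence

variable {ends : E → Sym2 V} {μ : Mark → V}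

/-- Open adjacency at a vertex of `S` only looks at the edges touching `S`. -/
lemma openAdj_congr_touches {S : Set V} {ω ω' : Config E}
    (h : ∀ e ∈ touches ends S, ω e = ω' e) {x y : V} (hx : x ∈ S) :
    OpenAdj ends ω x y ↔ OpenAdj ends ω' x y := by
  constructor
  · rintro ⟨e, he, hends⟩
    exact ⟨e, by rw [← h e ⟨x, hx, y, hends⟩]; exact he, hends⟩
  · rintro ⟨e, he, hends⟩
    exact ⟨e, by rw [h e ⟨x, hx, y, hends⟩]; exact he, hends⟩

/-- The inner configuration only looks at the edges not touching the roots. -/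
lemma innerConfig_congr {ω ω' : Config E}
    (h : ∀ e ∈ (touches ends {μ .a₁, μ .a₂})ᶜ, ω e = ω' e) :
    innerConfig ends μ ω = innerConfig ends μ ω' := by
  funext e
  by_cases he : e ∈ touches ends {μ .a₁, μ .a₂}
  · rw [innerConfig, innerConfig, delConfig_apply_of_mem he, delConfig_apply_of_mem he]
  · rw [innerConfig, innerConfig, delConfig_apply_of_notMem he, delConfig_apply_of_notMem he,
      h e he]

/-- The root-bundle state is determined by the edges at the roots. -/
lemma dependsOn_rootState : DependsOn (rootState ends μ) (touches ends {μ .a₁, μ .a₂}) := by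
  intro ω ω' h
  funext i
  unfold rootState
  rw [openAdj_congr_touches h (root_mem (bundle_fst_isRoot i))]

/-- The inner pattern is determined by the edges not touching the roots. -/
lemma dependsOn_innerPat : DependsOn (innerPat ends μ) (touches ends {μ .a₁, μ .a₂})ᶜ := by
  intro ω ω' h
  funext i
  unfold innerPat
  rw [innerConfig_congr h]

variable [Fintype E] [DecidableEq E] {R : Type*} [CommRing R]

/-- **Root bundles ⊥ inner pattern**: `P(W = w, Π = π) = P(W = w) · P(Π = π)`. -/
theorem prob_rootState_inter_innerPat (p : E → R) (w : Fin 7 → Bool) (π : Fin 3 → Bool) :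
    prob p ({ω | rootState ends μ ω = w} ∩ {ω | innerPat ends μ ω = π}) =
      prob p {ω | rootState ends μ ω = w} * prob p {ω | innerPat ends μ ω = π} := by
  classical
  refine prob_inter_eq_mul_of_dependsOn_compl p (touches ends {μ .a₁, μ .a₂}) ?_ ?_
  · intro ω ω' h
    show (rootState ends μ ω = w) = (rootState ends μ ω' = w)
    rw [dependsOn_rootState h]
  · intro ω ω' h
    show (innerPat ends μ ω = π) = (innerPat ends μ ω' = π)
    rw [dependsOn_innerPat h]

end Independence

section Partition

variable [Fintype E] [DecidableEq E] {R : Type*} [CommRing R]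

/-- **Partition of an event by a statistic**: `P(A) = Σ_s P(A ∩ {f = s})`. -/
lemma prob_eq_sum_fiber (p : E → R) {S : Type*} [Fintype S] [DecidableEq S] (f : Config E → S)
    (A : Set (Config E)) : prob p A = ∑ s, prob p (A ∩ {ω | f ω = s}) := by
  classical
  unfold prob
  rw [Finset.sum_comm]
  refine Finset.sum_congr rfl fun ω _ => ?_
  rw [Finset.sum_eq_single (f ω)]
  · by_cases hA : ω ∈ A
    · rw [Set.indicator_of_mem hA,
        Set.indicator_of_mem (show ω ∈ A ∩ {ω' | f ω' = f ω} from ⟨hA, rfl⟩)]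
    · rw [Set.indicator_of_notMem hA, Set.indicator_of_notMem (fun h => hA h.1)]
  · intro s _ hs
    exact Set.indicator_of_notMem (fun h => hs h.2.symm) _
  · intro h
    exact absurd (Finset.mem_univ _) h

variable {ends : E → Sym2 V} {μ : Mark → V}

/-- **The hub law**: the probability of an event determined by the state pair is the sum of
`P(W = w) · P(Π = π)` over the state pairs satisfying it. -/
theorem prob_hubEvent (p : E → R) (Φ : (Fin 7 → Bool) → (Fin 3 → Bool) → Prop)
    [∀ w π, Decidable (Φ w π)] :
    prob p {ω | Φ (rootState ends μ ω) (innerPat ends μ ω)} =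
      ∑ w, ∑ π, if Φ w π then
        prob p {ω | rootState ends μ ω = w} * prob p {ω | innerPat ends μ ω = π} else 0 := by
  classical
  rw [prob_eq_sum_fiber p (fun ω => (rootState ends μ ω, innerPat ends μ ω)),
    Fintype.sum_prod_type]
  refine Finset.sum_congr rfl fun w _ => Finset.sum_congr rfl fun π _ => ?_
  by_cases hΦ : Φ w π
  · rw [if_pos hΦ, ← prob_rootState_inter_innerPat]
    congr 1
    ext ω
    simp only [Set.mem_inter_iff, Set.mem_setOf_eq, Prod.mk.injEq]
    constructor
    · rintro ⟨_, hw, hπ⟩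
      exact ⟨hw, hπ⟩
    · rintro ⟨hw, hπ⟩
      exact ⟨by rw [hw, hπ]; exact hΦ, hw, hπ⟩
  · rw [if_neg hΦ]
    convert prob_empty p
    ext ω
    simp only [Set.mem_inter_iff, Set.mem_setOf_eq, Prod.mk.injEq, Set.mem_empty_iff_false,
      iff_false, not_and]
    rintro h rfl rfl
    exact hΦ h

end Partition

end Summit.Ventures.PercRepro2.Hub
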